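import Summits.BirchSwinnertonDyer.BirchSwinnertonDyer.Theorems.AdditiveBranchIMCTameLocalVanishingInertia
import Summits.BirchSwinnertonDyer.BirchSwinnertonDyer.Theorems.AdditiveBranchIMCTameLocalVanishingTwist
import Summits.BirchSwinnertonDyer.BirchSwinnertonDyer.Theorems.ErratumRoadFiveEulerHalfNotRamTateComponentSplitPlace
import Summits.BirchSwinnertonDyer.Rank1Residual.Additive.GordRankZeroChiBranch
import Summits.BirchSwinnertonDyer.Rank1Residual.Additive.N10LowerHalfStatements
import Literature.NumberTheory.EllipticCurves.TateModuleGaloisTransportProofs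
import Literature.NumberTheory.EllipticCurves.QuadraticTwistSelmerPInfty
import HarnessLib

/-!
# The TAME LOCAL VANISHING `E_K[p^∞]^{Gal(K̄/K̃_∞) ∩ I_{𝔭′}} = 0` on the (G-ord, `e = 2`) cell with `p ≥ 5` — the mathematics of
# the registered stub `stub_tameLocalVanishingR0` of line `three_field_road` (v19/v20, crux `AdditiveBranchIMC.GordTwoRankZeroOffCaseOne`,
# stmt-BirchSwinnertonDyer-19357; also `wan_tame_bdp_road` (19358) `stub_localVanishing`), with the cell binders UNFOLDED

Stub-worker seat `bsd-addord-k1tame-w2` (gen 0) under LEAD `cruxlead-19357` (LeadReport13 §3/§5). THEOREMS ONLY (no definition, no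
named fact, no `sorry`); BSD is proved for no curve; the crux item stays OPEN. The by-name-and-signature wrapper (which must repeat the
line vocabulary `TameLocalVanishingAt`) is the sibling file `…TameLocalVanishing.lean`.

THE STATEMENT. For `E = W/ℚ` on the cell (G-ord, `e = 2`) (`N10.CellGordTwo`: additive at `p`, potentially good ORDINARY,
semistability defect `2`), the tame sub-row (`p ≥ 5`, …) and a tame-road field `K` (imaginary quadratic, `p` split): for every
anticyclotomic `(κ, γ)`, every `𝔭′ ∋ p`, every completion `(κ₁, γ₁)` to a generator pair, `E_K[p^∞]` has NO non-zero point fixed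
by `pairKer κ₁ κ ∩ I_{𝔭′}` (`GreenbergSelmer.inertia`).

THE PROOF (the TAME MIRACLE, Serre 1972 §1.11 + local Kronecker–Weber), in three tree steps:
* the good-ordinary PARTNER `V`, `C • V^{(p*)} = W` (`TypeGOrd.exists_goodOrd_pStar_twist_model`), whose `V[p]` at every prime
  `𝔏 ∣ p` of `\bar ℤ` is a Borel with trivial quotient character under `I_𝔏` (Serre's ordinary line,
  `exists_line_of_not_dvd_frobeniusTrace_of_mem_primesAbove`);
* an element `σ ∈ pairKer κ₁ κ ∩ I_{𝔭′}` with `χ̄_p(res σ) = a` for a NON-SQUARE `a ≠ −1` (`p ≥ 5`): file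
  `…TameLocalVanishingInertia` (`exists_mem_pairKer_inf_inertia_modNCyclotomicCharacter_eq`: the `ℤ_p²`-tower is pro-`p` over
  `K`, so its inertia group at the completely split `p` still surjects onto `𝔽_pˣ`);
* `res σ` has no non-zero fixed point on `W[p^∞]` (file `…TameLocalVanishingTwist`, `eq_zero_of_smul_eq_of_pStar_twist`: on
  `W[p] ≅ V[p] ⊗ χ_{p*}` its eigenvalues are `−a, −1`), transported to `E_K[p^∞] = W[p^∞]|_{Γ_K}` along the base-change
  isomorphism (`exists_addEquiv_geomPoints_baseChange`).
`tameLocalVanishing_of_line` is the model-free core (ANY `ℚ`-model `W = C • V^{(p*)}` of a twist of an elliptic `V` whose `V[p]`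
is such a Borel at every `𝔏 ∣ p` — the (M) twin needs only the Tate-curve line in place of Serre's); `tameLocalVanishing_cellGordTwo`
is the body of the registered signature with `N10.CellGordTwo`, `5 ≤ p`, `[K : ℚ] = 2`, `p` split as its only binders.

References: [Serre1972] §1.11 Prop. 11 and Cor.; [SerreLocalFields1979] IV §4 Prop. 17; [SilvermanAEC2009] X.5 Cor. 5.4;
[Washington1997] §13.1; LeadReport13 §3, §5 (Cruxes/GordTwoRankZeroOffCaseOne).
-/

set_option linter.dupNamespace false

noncomputable section

open scoped Classical NumberField
open Field NumberField IsDedekindDomain WeierstrassCurve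
open Literature.NumberTheory.GaloisRepresentations Literature.NumberTheory.EllipticCurves
  Literature.NumberTheory.EllipticCurves.ZpExtension
  Literature.NumberTheory.EllipticCurves.Rank1Residual
  Summit.BirchSwinnertonDyer.Rank1Residual Summit.BirchSwinnertonDyer.Rank1Residual.Additive

namespace Summit.BirchSwinnertonDyer.BirchSwinnertonDyer.Theorems.TameLocalVanishing

/-! ### §0 Places of `ℚ` below a place of `K` -/

/-- `primesEquiv u = p` for a place `u` of `ℚ` containing the rational prime `p`. [folklore] -/
private theorem primesEquiv_eq_of_natCast_mem {u : HeightOneSpectrum (𝓞 ℚ)} {p : ℕ}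
    (hp : p.Prime) (hu : (p : 𝓞 ℚ) ∈ u.asIdeal) :
    (Rat.HeightOneSpectrum.primesEquiv u : ℕ) = p := by
  have h1 : Rat.HeightOneSpectrum.natGenerator u ∣ p := by
    rw [Rat.HeightOneSpectrum.natGenerator_dvd_iff]
    have h2 := Ideal.mem_map_of_mem (Rat.IsIntegralClosure.intEquiv (𝓞 ℚ)) hu
    rwa [map_natCast] at h2
  exact (Nat.prime_dvd_prime_iff_eq (Rat.HeightOneSpectrum.prime_natGenerator u) hp).mp h1

/-- A place of a number field containing the rational prime `p` lies above the place `(p)` of `ℚ`. [folklore] -/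
private theorem natCast_mem_under_rat {K : Type*} [Field K] [NumberField K]
    {w : HeightOneSpectrum (𝓞 K)} {p : ℕ} (hpw : ((p : ℕ) : 𝓞 K) ∈ w.asIdeal) :
    (p : 𝓞 ℚ) ∈ (w.under (𝓞 ℚ)).asIdeal := by
  rw [HeightOneSpectrum.under_asIdeal, Ideal.under_def, Ideal.mem_comap, map_natCast]
  exact hpw

/-! ### §1 Base change of `p`-primary torsion along `Γ_K → Γ_ℚ` -/

/-- Restriction to `p`-primary torsion of an additive isomorphism equivariant ALONG a group homomorphism (here
`res : Γ_K → Γ_ℚ` and `E(ℚ̄) ≃ E_K(K̄)`, `exists_addEquiv_geomPoints_baseChange`) is again equivariant along it. [folklore] -/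
theorem primaryComponentCongr_smul_of_smul_res {F L : Type} [Field F] [Field L] [Algebra F L]
    {W : WeierstrassCurve F} (p : ℕ) (ψ : geomPoints W ≃+ geomPoints (W.baseChange L))
    (hψ : ∀ (γ : absoluteGaloisGroup L) (P : geomPoints W), ψ (absGaloisRestrict F L γ • P) = γ • ψ P)
    (γ : absoluteGaloisGroup L) (m : ↥(W.geomPrimaryTorsion p)) :
    primaryComponentCongr ψ p (absGaloisRestrict F L γ • m) = γ • primaryComponentCongr ψ p m :=
  Subtype.ext (by
    simp only [coe_primaryComponentCongr, primaryComponent.coe_smul]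
    exact hψ γ _)

/-! ### §2 The model-free core -/

/-- **TAME LOCAL VANISHING, model-free core.** Let `V/ℚ` be elliptic, `p ≥ 5`, `W = C • V^{(p*)}` a `ℚ`-model of the twist,
and suppose that at every prime `𝔏 ∣ p` of `\bar ℤ` the inertia group acts on `V[p]` through a Borel with trivial quotient
character (`∃ v₀ ≠ 0, ∀ τ ∈ I_𝔏, ∀ x, τx − x ∈ 𝔽_p v₀` — Serre's ordinary line, or the Tate-curve line). Let `K` be a quadratic
field in which `p` splits, `κ₁, κ₂` ANY two `ℤ_p`-extensions of `K` and `𝔭′ ∋ p`. Then `E_K[p^∞]` (`E = W`) has no non-zero point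
fixed by `pairKer κ₁ κ₂ ∩ I_{𝔭′}`. [cite: Serre1972, §1.11 Prop. 11 and Cor.] [cite: SerreLocalFields1979, Ch. IV §4 Prop. 17]
[cite: SilvermanAEC2009, X.5 Cor. 5.4] -/
theorem tameLocalVanishing_of_line (V : WeierstrassCurve ℚ) [V.IsElliptic] (W : WeierstrassCurve ℚ) (p : ℕ)
    [hp : Fact p.Prime] (hp5 : 5 ≤ p)
    (hCW : ∃ C : VariableChange ℚ, C • V.quadraticTwist ((-1 : ℚ) ^ (p / 2) * p) = W)
    (hline : ∀ (u : HeightOneSpectrum (𝓞 ℚ)), (Rat.HeightOneSpectrum.primesEquiv u : ℕ) = p →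
      ∀ 𝔏 ∈ u.primesAbove,
        letI : Module (ZMod p) (geomTorsion V p) := AddSubgroup.torsionBy.zmodModule
        ∃ v₀ : geomTorsion V p, v₀ ≠ 0 ∧ ∀ τ ∈ 𝔏.inertia (absoluteGaloisGroup ℚ), ∀ x : geomTorsion V p,
          ∃ b : ZMod p, τ • x - x = b • v₀)
    (K : Type) [Field K] [NumberField K] (hK2 : Module.finrank ℚ K = 2)
    (hsplitK : ((Ideal.span {(p : ℤ)}).primesOver (𝓞 K)).ncard = 2)
    (κ₁ κ₂ : ZpExtension K p) (𝔭' : HeightOneSpectrum (𝓞 K)) (h𝔭' : ((p : ℕ) : 𝓞 K) ∈ 𝔭'.asIdeal)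
    (m : ↥((W.baseChange K).geomPrimaryTorsion p))
    (hm : ∀ x : absoluteGaloisGroup K, x ∈ pairKer κ₁ κ₂ → x ∈ GreenbergSelmer.inertia 𝔭' → x • m = m) :
    m = 0 := by
  have hpr : p.Prime := hp.out
  have hp2 : p ≠ 2 := by omega
  haveI : Algebra.IsQuadraticExtension ℚ K := ⟨hK2⟩
  haveI : IsGalois ℚ K := inferInstance
  -- the place `u = (p)` of `ℚ` below `𝔭'`, and the complete splitting of `(p)` in `K`
  set u : HeightOneSpectrum (𝓞 ℚ) := 𝔭'.under (𝓞 ℚ) with hu_def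
  have hu : (Rat.HeightOneSpectrum.primesEquiv u : ℕ) = p :=
    primesEquiv_eq_of_natCast_mem hpr (natCast_mem_under_rat h𝔭')
  have hwu : 𝔭'.asIdeal.under (𝓞 ℚ) = u.asIdeal := (HeightOneSpectrum.under_asIdeal (𝓞 ℚ) 𝔭').symm
  obtain ⟨vbar, hne, hpvbar⟩ := TateComponent.exists_ne_of_ncard_primesOver_eq_two hpr hsplitK 𝔭' h𝔭'
  have hsplit : (u.asIdeal.primesOver (𝓞 K)).ncard = Module.finrank ℚ K := by
    rw [hu_def]
    exact ncard_primesOver_under_eq_finrank_of_ne hK2 h𝔭' hpvbar hne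
  -- a non-square `a ≠ -1` mod `p`, and `σ ∈ pairKer ⊓ I_{𝔭'}` with `χ̄_p(res σ) = a`
  obtain ⟨a, hχa, hane⟩ := exists_nonsquare_ne_neg_one (p := p) hp5
  have ha0 : a ≠ 0 := by
    rintro rfl
    rw [quadraticChar_zero] at hχa
    norm_num at hχa
  obtain ⟨σ, hσ, hσa⟩ :=
    exists_mem_pairKer_inf_inertia_modNCyclotomicCharacter_eq κ₁ κ₂ hu hsplit hwu (Units.mk0 a ha0)
  obtain ⟨hσP, hσI⟩ := Subgroup.mem_inf.mp hσ
  -- `res σ ∈ I_𝔔`, `𝔔 ∣ p` a prime of `\bar ℤ_ℚ`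
  have hτ := absGaloisRestrict_mem_inertia_comap_of_mem_inertia hσI
  have h𝔔 := comap_adicCompletionPrime_mem_primesAbove (K := K) hwu
  have hχ : quadraticChar (ZMod p)
      ((modNCyclotomicCharacter ℚ p (absGaloisRestrict ℚ K σ) : (ZMod p)ˣ) : ZMod p) = -1 := by
    rw [hσa, Units.val_mk0]; exact hχa
  have hne' : ((modNCyclotomicCharacter ℚ p (absGaloisRestrict ℚ K σ) : (ZMod p)ˣ) : ZMod p) ≠ -1 := by
    rw [hσa, Units.val_mk0]; exact hane
  -- transport `m` to `W[p^∞]` along the base-change isomorphism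
  obtain ⟨ψ, hψ⟩ := W.exists_addEquiv_geomPoints_baseChange K
  set m₀ : ↥(W.geomPrimaryTorsion p) := (primaryComponentCongr ψ p).symm m with hm₀
  have hmm₀ : primaryComponentCongr ψ p m₀ = m := (primaryComponentCongr ψ p).apply_symm_apply m
  have hfix : absGaloisRestrict ℚ K σ • m₀ = m₀ := by
    apply (primaryComponentCongr ψ p).injective
    rw [primaryComponentCongr_smul_of_smul_res p ψ hψ, hmm₀]
    exact hm σ hσP hσI
  have h0 : m₀ = 0 :=
    eq_zero_of_smul_eq_of_pStar_twist V p hp2 hCW (hline u hu _ h𝔔) hτ hχ hne' hfix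
  rw [← hmm₀, h0, map_zero]

/-! ### §3 The cell (G-ord, `e = 2`), `p ≥ 5`, `K` quadratic with `p` split -/

/-- **TAME LOCAL VANISHING on the cell (G-ord, `e = 2`)** — the body of the registered stub `stub_tameLocalVanishingR0` with its
binders unfolded to what is used: `N10.CellGordTwo W p` (the good-ordinary partner `V`, `C • V^{(p*)} = W`,
`TypeGOrd.exists_goodOrd_pStar_twist_model`; Serre's ordinary line of `V[p]` at every `𝔏 ∣ p`,
`exists_line_of_not_dvd_frobeniusTrace_of_mem_primesAbove`), `5 ≤ p`, `[K : ℚ] = 2`, `p` split in `K`. For ANY two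
`ℤ_p`-extensions `κ₁, κ₂` of `K` and `𝔭′ ∋ p`: a point of `E_K[p^∞]` fixed by `pairKer κ₁ κ₂ ∩ I_{𝔭′}` is `0`.
[cite: Serre1972, §1.11 Prop. 11 and Cor.] [cite: SerreLocalFields1979, Ch. IV §4 Prop. 17] [cite: SilvermanAEC2009, X.5 Cor. 5.4] -/
theorem tameLocalVanishing_cellGordTwo (W : WeierstrassCurve ℚ) [W.IsElliptic] [W.IsGloballyMinimal] (p : ℕ)
    [hp : Fact p.Prime] (K : Type) [Field K] [NumberField K] (hcell : N10.CellGordTwo W p) (hp5 : 5 ≤ p)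
    (hK2 : Module.finrank ℚ K = 2) (hsplitK : ((Ideal.span {(p : ℤ)}).primesOver (𝓞 K)).ncard = 2)
    (κ₁ κ₂ : ZpExtension K p) (𝔭' : HeightOneSpectrum (𝓞 K)) (h𝔭' : ((p : ℕ) : 𝓞 K) ∈ 𝔭'.asIdeal)
    (m : ↥((W.baseChange K).geomPrimaryTorsion p))
    (hm : ∀ x : absoluteGaloisGroup K, x ∈ pairKer κ₁ κ₂ → x ∈ GreenbergSelmer.inertia 𝔭' → x • m = m) :
    m = 0 := by
  -- the good-ordinary partner `V`, `C • V^{(p*)} = W`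
  obtain ⟨V, hVell, hVmin, C, hord, hCW⟩ :=
    TypeGOrd.exists_goodOrd_pStar_twist_model W p hcell.1 hcell.2.2.1 hcell.2.1 hcell.2.2.2
  -- Serre's ordinary line of `V[p]` at every prime of `\bar ℤ` above `p`
  have hΔ := V.not_dvd_minimalDiscriminantInt_of_hasGoodReductionAtPrime' p hord.1
  refine tameLocalVanishing_of_line V W p hp5 ⟨C, hCW⟩ (fun u hu 𝔏 h𝔏 ↦ ?_) K hK2 hsplitK κ₁ κ₂ 𝔭' h𝔭' m hm
  exact exists_line_of_not_dvd_frobeniusTrace_of_mem_primesAbove p hΔ hord.2 hu h𝔏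

end Summit.BirchSwinnertonDyer.BirchSwinnertonDyer.Theorems.TameLocalVanishing

end
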